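import Summits.Langlands.Langlands.Theses.DyadicOddResidue
import Summits.Langlands.Langlands.Theses.OddResidueBelowFive
import Summits.Langlands.Langlands.Theorems.DyadicDihedralFM.Negative.SolvableRangeChoiceFree
import Summits.Langlands.Langlands.Theorems.DyadicDihedralFM.Negative.OddnessResiduallyInvisible
import Literature.NumberTheory.GaloisRepresentations.SolvableDihedralCharTwo
import Literature.NumberTheory.GaloisRepresentations.ResidualGaloisRepOpenKernel
import Literature.RingTheory.Valuation.AlgClosedResidue
import Summits.Langlands.Langlands.Theorems.ParityBlindBianchiArtinWeightRealisationLevelRouteSectorTarget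
import HarnessLib

/-!
# The two typings of the dyadic dihedral cell agree:
# `OddResidueBelowFive.TwoAdicDihedral ↔ DyadicOddResidue.DyadicDihedralFM`

Two routes opened one minute apart type the same open cell of the Fontaine–Mazur conjecture over
`ℚ` at `ℓ = 2` — `ρ` odd, irreducible, a.e. unramified, de Rham at `2` with distinct labelled
Hodge–Tate weights, residually absolutely irreducible with SMALL image — in two vocabularies:

* `Summit.Langlands.Langlands.Theses.OddResidueBelowFive.TwoAdicDihedral` (stmt-Langlands-18716):
  `IsDihedralType ρ.residualRep` (projective image `≃ D_m`, `m ≥ 2`);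
* `Summit.Langlands.Langlands.Theses.DyadicOddResidue.DyadicDihedralFM` (stmt-Langlands-18742):
  `IsSolvable ρ.residualRep.range` (and `ℓ` bound as `∀ ℓ, ℓ = 2 → …`).

Allen (Compositio 150 (2014), p. 2): "any absolutely irreducible, 2-dimensional, mod 2
representation with solvable image is dihedral, by the classification of subgroups of
`PGL₂(𝔽̄₂)`".  Both directions are now in the tree's Literature:
dihedral type ⇒ solvable image (`isSolvable_projectiveImage_iff` + solvability of `D_m`), and
Dickson in characteristic `2` (`isDihedralType_of_isIrreducible_of_isSolvable_of_charTwo`,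
Khare–Wintenberger (I) Lemma 6.1).  This file proves the equivalence of the two route statements
(`twoAdicDihedral_iff_dyadicDihedralFM`), so that the cell is staffed once: a proof (or a
refutation) of either item settles the other by a one-line transport.

Ingredients: under `ρ.IsResiduallyAbsIrreducible` the chosen `ρ.residualRep` is a genuine residual
representation (`residualRep_isResidualRepOf`, Negative/SolvableRangeChoiceFree), hence
Brauer–Nesbitt-equivalent to the absolutely irreducible reduction, hence irreducible
(`isIrreducible_toStdRepresentation_residualRep`); its kernel is open
(`isOpen_ker_of_isResidualRepOf`), so its image is finite (`Γ_ℚ` compact); the residue field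
`ℤ̄₂/𝔪` is algebraically closed of characteristic `2` (`isAlgClosed_residueField`,
`charP_padicAlgClResidueField`).  Sorry-free; axioms `propext`, `Classical.choice`, `Quot.sound`.
-/

noncomputable section

namespace Summit.Langlands.Langlands.Theorems.DyadicDihedralFM

set_option linter.dupNamespace false -- project-wide option; `Summit.Langlands.Langlands` is the mandated namespace

open scoped MatrixGroups
open Literature.NumberTheory.GaloisRepresentations IsLocalRing
open Summit.Langlands.Langlands.Theorems.DyadicDihedralFM.Negative

variable {K : Type} [Field K] [NumberField K] {ℓ : ℕ} [Fact ℓ.Prime] {n : ℕ}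

/-- The residue field `ℤ̄_ℓ/𝔪` of `ℚ̄_ℓ` is algebraically closed (residue field of a valuation
ring of an algebraically closed field). [folklore] -/
theorem isAlgClosed_padicAlgClResidueField (ℓ : ℕ) [Fact ℓ.Prime] :
    IsAlgClosed (padicAlgClResidueField ℓ) :=
  Literature.RingTheory.Valuation.isAlgClosed_residueField (padicAlgClIntegers ℓ)

/-- Under `hres` the chosen residual representation has FINITE image: its kernel is open
(`isOpen_ker_of_isResidualRepOf`) in the compact group `Γ_K`. [folklore] -/
theorem finite_range_residualRep (ρ : FramedGaloisRep K (PadicAlgCl ℓ) n)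
    (hres : ρ.IsResiduallyAbsIrreducible) : Finite ρ.residualRep.range := by
  have hopen : IsOpen (ρ.residualRep.ker : Set (Field.absoluteGaloisGroup K)) :=
    FramedGaloisRep.isOpen_ker_of_isResidualRepOf (residualRep_isResidualRepOf ρ hres)
  haveI : Finite (Field.absoluteGaloisGroup K ⧸ ρ.residualRep.ker) :=
    Subgroup.quotient_finite_of_isOpen _ hopen
  exact Finite.of_equiv _ (QuotientGroup.quotientKerEquivRange ρ.residualRep).toEquiv

omit [NumberField K] in
/-- Under `hres` the chosen residual representation is IRREDUCIBLE on `(ℤ̄_ℓ/𝔪)ⁿ`: it is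
Brauer–Nesbitt-equivalent to the absolutely irreducible reduction witnessing `hres`
(`nonempty_equiv_of_isResidualRepOf`), and irreducibility passes along equivalences. [folklore] -/
theorem isIrreducible_toStdRepresentation_residualRep (ρ : FramedGaloisRep K (PadicAlgCl ℓ) n)
    (hres : ρ.IsResiduallyAbsIrreducible) : (toStdRepresentation ρ.residualRep).IsIrreducible := by
  obtain ⟨τ, hτ, habs⟩ := hres
  have hirrτ : (glRepresentation τ).IsIrreducible := isIrreducible_of_isAbsIrreducible habs
  have hτ' : ρ.IsResidualRepOf (RingHom.id _) τ := hτ.isResidualRepOf_of_isIrreducible hirrτ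
  have hρ' : ρ.IsResidualRepOf (RingHom.id _) ρ.residualRep :=
    residualRep_isResidualRepOf ρ ⟨τ, hτ, habs⟩
  obtain ⟨e⟩ := nonempty_equiv_of_isResidualRepOf ρ hτ' hρ'
  haveI := hirrτ
  exact Literature.RepresentationTheory.Semisimple.Representation.isIrreducible_of_equiv e

/-- **Dickson in characteristic `2`, for the residual representation of a `2`-adic `ρ`**:
residually absolutely irreducible with solvable residual image ⇒ the residual representation is
of dihedral type (Allen 2014, p. 2; Khare–Wintenberger (I), Lemma 6.1, tree theorem
`isDihedralType_of_isIrreducible_of_isSolvable_of_charTwo`). -/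
theorem isDihedralType_residualRep_of_isSolvable (ρ : FramedGaloisRep K (PadicAlgCl 2) 2)
    (hres : ρ.IsResiduallyAbsIrreducible) (hsol : IsSolvable ρ.residualRep.range) :
    IsDihedralType ρ.residualRep := by
  haveI : IsAlgClosed (padicAlgClResidueField 2) := isAlgClosed_padicAlgClResidueField 2
  haveI : CharP (padicAlgClResidueField 2) 2 := charP_padicAlgClResidueField 2
  haveI : Finite ρ.residualRep.range := finite_range_residualRep ρ hres
  exact isDihedralType_of_isIrreducible_of_isSolvable_of_charTwo ρ.residualRep
    (isIrreducible_toStdRepresentation_residualRep ρ hres) hsol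

/-- **Dihedral type ⇒ solvable image** (any coefficients): the projective image is a dihedral
group, which is solvable (`dihedralGroup_isSolvable'`, reused from
`Theorems/ParityBlindBianchiArtinWeightRealisationLevelRouteSectorTarget`), and solvability of the
projective image is solvability of the image (`isSolvable_projectiveImage_iff`). [folklore] -/
theorem isSolvable_range_of_isDihedralType {G : Type*} [Group G] {k : Type*} [CommRing k] {m : ℕ}
    (τ : G →* GL (Fin m) k) (h : IsDihedralType τ) : IsSolvable τ.range := by
  obtain ⟨d, -, ⟨e⟩⟩ := h
  rw [← isSolvable_projectiveImage_iff]
  haveI := Summit.Langlands.Langlands.Theorems.ArtinWeightRealisationLevel.dihedralGroup_isSolvable' d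
  exact solvable_of_solvable_injective (f := e.toMonoidHom) e.injective

/-- **The two typings of the dyadic dihedral cell are equivalent**:
`OddResidueBelowFive.TwoAdicDihedral` (stmt-Langlands-18716, `IsDihedralType ρ.residualRep`) ↔
`DyadicOddResidue.DyadicDihedralFM` (stmt-Langlands-18742, `IsSolvable ρ.residualRep.range`).
All other clauses are verbatim the same (up to the order of the binders `ι`, `hcpt` and the
bound prime `ℓ = 2`). -/
theorem twoAdicDihedral_iff_dyadicDihedralFM :
    Summit.Langlands.Langlands.Theses.OddResidueBelowFive.TwoAdicDihedral ↔
      Summit.Langlands.Langlands.Theses.DyadicOddResidue.DyadicDihedralFM := by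
  constructor
  · intro h ℓ _ hℓ ρ hres hsol hirr hodd hunr hdR hcpt ι
    subst hℓ
    exact h ρ hodd hirr hunr hdR hres (isDihedralType_residualRep_of_isSolvable ρ hres hsol) ι hcpt
  · intro h ρ hodd hirr hunr hdR hres hdih ι hcpt
    exact h 2 rfl ρ hres (isSolvable_range_of_isDihedralType ρ.residualRep hdih) hirr hodd hunr hdR
      hcpt ι

/-- Transport in the useful direction for this line: a proof of the crux `DyadicDihedralFM`
settles the twin `TwoAdicDihedral`. -/
theorem twoAdicDihedral_of_dyadicDihedralFM
    (h : Summit.Langlands.Langlands.Theses.DyadicOddResidue.DyadicDihedralFM) :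
    Summit.Langlands.Langlands.Theses.OddResidueBelowFive.TwoAdicDihedral :=
  twoAdicDihedral_iff_dyadicDihedralFM.2 h

/-- … and conversely a proof of the twin settles the crux. -/
theorem dyadicDihedralFM_of_twoAdicDihedral
    (h : Summit.Langlands.Langlands.Theses.OddResidueBelowFive.TwoAdicDihedral) :
    Summit.Langlands.Langlands.Theses.DyadicOddResidue.DyadicDihedralFM :=
  twoAdicDihedral_iff_dyadicDihedralFM.1 h

end Summit.Langlands.Langlands.Theorems.DyadicDihedralFM

end
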